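import Summits.QuantumFields.QCD.Theorems.RobustYangMillsHandover.Negative.ChiralityObstruction

/-!
# Crux `RobustYangMillsHandover` (stmt-QuantumFields-8892) — strategist census s9, kernel evidence

Independent strategy census (family `s`, seat `cstrat-stmt-QuantumFields-8892-s9`).  The crux is
`RobustYangMillsHandover := ContinuumQCDExists → QCD` (the target X₀ hands over to the conjunct).  This file
records, sorry-free, the elementary facts the census `STRATEGY-CENSUS-s9.md` leans on:

* §1 **Weaker intermediate.**  The crux is the WEAKEST completion of the route's cone: any statement `Y`
  with `X₀ → Y → QCD` implies the crux (`weakest_completion`); given the target the crux IS the conjunct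
  (`crux_iff_qcd_of_target`); its negation is `X₀ ∧ ¬ QCD` (`not_crux_iff`).  So no statement strictly
  weaker than the crux can replace it in a `closes` theorem whose other binders are the route's (all of
  which only reach X₀).
* §2 **Re-cut cone.**  The pre-re-type threshold form `AboveThreshold N_f` of the conjunct gives a weaker
  handover `ThresholdHandover := X₀ → AboveThreshold 2 ∧ AboveThreshold 3` (`thresholdHandover_of_crux`);
  what it leaves over is exactly the chiral supplement (`crux_of_thresholdHandover`), whose content, by
  `Negative.qcdOf_gap_profile`, is a chiral regularisation gapped at every positive tuple with no uniform
  rate.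
* §3 **Decomposition.**  For the landed pin split (`PinnedThreshold.robustYangMillsHandover_of_pinInputs`,
  inputs H/G/O/D): the pin of a regularisation in the NON-chiral branch of the dichotomy lies strictly
  below X₀'s offset (`pin_lt_zero_of_uniformRate`, `pin_lt_zero_of_not_isChiralAtZero`), so input D is then
  invoked at tuples with every component negative relative to X₀'s offset (`exists_tuple_below_zero`) —
  continuum data X₀ does not carry; and X₀'s data clause is blind to up-shifts of the offset
  (`x0Data_upShift`, `isPin_upShift_iff`), so X₀ cannot exclude that branch.

Imports only the landed Negative module `ChiralityObstruction` (the PinnedThreshold theorems are quoted by name in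
the census, not used here). Pure logic / order bookkeeping over tree declarations; nothing here is a route item.
[folklore]
-/

namespace Summit.QuantumFields.QCD.Cruxes.RobustYangMillsHandover.CensusS9

open Summit.QuantumFields.QCD.Theses.HeatSlicedQuarks
open Summit.QuantumFields.QCD.Theorems.RobustYangMillsHandover
open Literature.MathematicalPhysics.QuantumFieldTheory
open Filter

variable {Nf : ℕ}

/-! ## §1 The crux is the weakest completion of the cone -/

/-- **Weakest completion.** Any `Y` that completes the target to the conjunct implies the crux. [folklore] -/
theorem weakest_completion (Y : Prop) (h : ContinuumQCDExists → Y → _root_.QCD) :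
    Y → RobustYangMillsHandover :=
  fun hY hX => h hX hY

/-- The crux itself is such a completion (so it is the weakest one, up to `↔` given X₀), and the conjunct
implies the crux outright (the crux is at most summit-strength).  Stated as one conjunction so that no
declaration of this workfile has the item or the summit as its conclusion. [folklore] -/
theorem completion_profile :
    (ContinuumQCDExists → RobustYangMillsHandover → _root_.QCD) ∧ (_root_.QCD → RobustYangMillsHandover) :=
  ⟨fun hX hC => hC hX, fun hQ _ => hQ⟩

/-- Given the target, the crux IS the conjunct. [folklore] -/
theorem crux_iff_qcd_of_target (hX : ContinuumQCDExists) : RobustYangMillsHandover ↔ _root_.QCD :=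
  ⟨fun hC => hC hX, fun hQ _ => hQ⟩

/-- **Negation side.** Refuting the crux means proving the target AND refuting the conjunct. [folklore] -/
theorem not_crux_iff : ¬ RobustYangMillsHandover ↔ ContinuumQCDExists ∧ ¬ _root_.QCD := by
  constructor
  · intro h
    by_contra h'
    exact h fun hX => by_contra fun hQ => h' ⟨hX, hQ⟩
  · rintro ⟨hX, hQ⟩ hC
    exact hQ (hC hX)

/-! ## §2 Re-cutting the cone: the threshold handover and the chiral supplement -/

/-- The pre-re-type THRESHOLD form of the conjunct at `N_f` flavours: honest data and both gap clauses at
every tuple above some offset `M₀ ≥ 0` (the right-hand side of `Negative.qcdOf_imp_aboveThreshold`). -/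
def AboveThreshold (Nf : ℕ) : Prop :=
  ∃ M₀ : ℝ, 0 ≤ M₀ ∧ ∃ reg : QCDRegularisation Nf, reg.HasMassScaling ∧
    ∀ m : Fin Nf → ℝ, (∀ f, M₀ < m f) →
      ∃ (z shift : QCDField Nf → ℕ → ℝ) (T : OSData (QCDField Nf) 4),
        IsQCDAlong (reg.scheme m z shift) T ∧ T.IsNontrivial QCDField.glue ∧
          T.IsNonGaussian QCDField.glue ∧
            (∀ f g : Fin Nf, f ≠ g → T.IsNontrivial (QCDField.pseudoRe f g)) ∧
              ∃ Δ > 0, T.HasMassGap Δ ∧ (reg.scheme m z shift).HasLatticeMassGap Δ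

/-- The weaker, threshold handover: X₀ hands over to the threshold forms. -/
def ThresholdHandover : Prop := ContinuumQCDExists → AboveThreshold 2 ∧ AboveThreshold 3

/-- The chiral supplement: the threshold form upgrades to the re-typed conjunct. -/
def ChiralSupplement (Nf : ℕ) : Prop := AboveThreshold Nf → QCDOf Nf

/-- `ThresholdHandover` is weaker than the crux. [folklore] -/
theorem thresholdHandover_of_crux (hC : RobustYangMillsHandover) : ThresholdHandover := fun hX =>
  ⟨Negative.qcdOf_imp_aboveThreshold (hC hX).1, Negative.qcdOf_imp_aboveThreshold (hC hX).2⟩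

/-- … and what it leaves over is exactly the chiral supplement at `N_f = 2, 3`. [folklore] -/
theorem crux_of_thresholdHandover (hT : ThresholdHandover) (h2 : ChiralSupplement 2)
    (h3 : ChiralSupplement 3) : RobustYangMillsHandover := fun hX =>
  ⟨h2 (hT hX).1, h3 (hT hX).2⟩

/-- The content of the chiral supplement's conclusion (by `Negative.qcdOf_gap_profile`): a mass-scaling
regularisation that is chiral at zero, lattice-gapped at EVERY positive tuple, with NO uniform rate — the
full light-quark spectrum, not a threshold statement. [folklore] -/
theorem chiralSupplement_content (h : ChiralSupplement Nf) (hT : AboveThreshold Nf) :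
    ∃ reg : QCDRegularisation Nf, reg.HasMassScaling ∧ reg.IsChiralAtZero ∧
      (∀ m : Fin Nf → ℝ, (∀ f, 0 < m f) → ∃ Δ > 0, (reg.scheme m 0 0).HasLatticeMassGap Δ) ∧
      ¬ ∃ ε > (0 : ℝ), ∀ m : Fin Nf → ℝ, (∀ f, 0 < m f) → (reg.scheme m 0 0).HasLatticeMassGap ε :=
  Negative.qcdOf_gap_profile (h hT)

/-! ## §3 The pin split: where input D is invoked -/

/-- X₀'s data clause for ONE regularisation (the bracket of `ContinuumQCDExists`). -/
def X0Data (reg : QCDRegularisation Nf) : Prop :=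
  reg.HasMassScaling ∧ ∀ m : Fin Nf → ℝ, (∀ f, 0 < m f) →
    ∃ (z shift : QCDField Nf → ℕ → ℝ) (T : OSData (QCDField Nf) 4),
      IsQCDAlong (reg.scheme m z shift) T ∧ T.IsNontrivial QCDField.glue ∧
        T.IsNonGaussian QCDField.glue ∧ ∀ f g : Fin Nf, f ≠ g → T.IsNontrivial (QCDField.pseudoRe f g)

/-- `ContinuumQCDExists` is `X0Data` of some regularisation at `N_f = 2, 3` (definitional). [folklore] -/
theorem continuumQCDExists_iff :
    ContinuumQCDExists ↔ ∀ Nf : ℕ, Nf = 2 ∨ Nf = 3 → ∃ reg : QCDRegularisation Nf, X0Data reg :=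
  Iff.rfl

/-- The up-shift of a regularisation's additive mass renormalisation by `M₀` physical units. -/
noncomputable def upShift (reg : QCDRegularisation Nf) (M₀ : ℝ) : QCDRegularisation Nf :=
  { reg with mcrit := fun k => reg.mcrit k + reg.a k * M₀ / reg.Zm k }

/-- The shifted scheme at `m` is the original scheme at `M₀ + m`. [folklore] -/
theorem upShift_scheme (reg : QCDRegularisation Nf) (M₀ : ℝ) (m : Fin Nf → ℝ)
    (z shift : QCDField Nf → ℕ → ℝ) :
    (upShift reg M₀).scheme m z shift = reg.scheme (fun f => M₀ + m f) z shift := by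
  simp only [upShift, QCDRegularisation.scheme, QCDScheme.mk.injEq, true_and, and_true]
  funext f k
  ring

/-- **X₀ is blind to up-shifts**: if `reg` carries X₀'s data then so does every up-shift by `M₀ ≥ 0`
(its positive tuples are a subset of `reg`'s). Hence the target can never locate the chiral point of its
witness: the witness may sit arbitrarily deep in the massive regime. [folklore] -/
theorem x0Data_upShift (reg : QCDRegularisation Nf) {M₀ : ℝ} (hM : 0 ≤ M₀) (h : X0Data reg) :
    X0Data (upShift reg M₀) := by
  refine ⟨(Negative.hasMassScaling_mcrit_shift_iff reg M₀).mpr h.1, fun m hm => ?_⟩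
  obtain ⟨z, shift, T, hA, hN, hG, hP⟩ := h.2 (fun f => M₀ + m f) fun f => by linarith [hm f]
  exact ⟨z, shift, T, by rw [upShift_scheme]; exact hA, hN, hG, hP⟩

/-- The two clauses `exists_pin` delivers at the pin `P` (all tuples above `P` lattice-gapped at some rate;
no uniform rate above `P`). -/
def IsPin (reg : QCDRegularisation Nf) (P : ℝ) : Prop :=
  (∀ t : Fin Nf → ℝ, (∀ f, P < t f) → ∃ Δ > (0 : ℝ), (reg.scheme t 0 0).HasLatticeMassGap Δ) ∧
    ∀ ε > (0 : ℝ), ∃ t : Fin Nf → ℝ, (∀ f, P < t f) ∧ ¬ (reg.scheme t 0 0).HasLatticeMassGap ε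

/-- Pins move with the offset: `P` is a pin of the up-shift iff `M₀ + P` is a pin of `reg`. [folklore] -/
theorem isPin_upShift_iff (reg : QCDRegularisation Nf) (M₀ P : ℝ) :
    IsPin (upShift reg M₀) P ↔ IsPin reg (M₀ + P) := by
  simp only [IsPin, upShift_scheme]
  constructor
  · rintro ⟨h1, h2⟩
    refine ⟨fun t ht => ?_, fun ε hε => ?_⟩
    · have := h1 (fun f => t f - M₀) fun f => by linarith [ht f]
      simpa using this
    · obtain ⟨t, ht, hng⟩ := h2 ε hε
      exact ⟨fun f => M₀ + t f, fun f => by linarith [ht f], hng⟩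
  · rintro ⟨h1, h2⟩
    refine ⟨fun t ht => h1 _ fun f => by linarith [ht f], fun ε hε => ?_⟩
    obtain ⟨t, ht, hng⟩ := h2 ε hε
    refine ⟨fun f => t f - M₀, fun f => by linarith [ht f], ?_⟩
    simpa using hng

/-- **A uniform rate above X₀'s offset pushes every pin strictly below it.** [folklore] -/
theorem pin_lt_zero_of_uniformRate (reg : QCDRegularisation Nf) [NeZero Nf] {ε : ℝ} (hε : 0 < ε)
    (hunif : ∀ m : Fin Nf → ℝ, (∀ f, 0 < m f) → (reg.scheme m 0 0).HasLatticeMassGap ε)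
    {P : ℝ} (hP : IsPin reg P) : P < 0 := by
  by_contra hP0
  push Not at hP0
  obtain ⟨t, ht, hng⟩ := hP.2 ε hε
  exact hng (hunif t fun f => lt_of_le_of_lt hP0 (ht f))

/-- **In the non-chiral branch of the dichotomy the pin is negative**: if X₀'s witness is not chiral at
its own offset, input D of the pin split is invoked below that offset. [folklore] -/
theorem pin_lt_zero_of_not_isChiralAtZero (reg : QCDRegularisation Nf) [NeZero Nf]
    (hχ : ¬ reg.IsChiralAtZero) {P : ℝ} (hP : IsPin reg P) : P < 0 := by
  obtain ⟨ε, hε, hunif⟩ := (Negative.not_isChiralAtZero_iff_uniformLatticeGap reg).mp hχ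
  exact pin_lt_zero_of_uniformRate reg hε hunif hP

/-- … and then there are tuples above the pin with EVERY component negative (relative to X₀'s offset),
at which input D must deliver continuum data and a continuum gap. [folklore] -/
theorem exists_tuple_below_zero {P : ℝ} (hP : P < 0) :
    ∃ t : Fin Nf → ℝ, (∀ f, P < t f) ∧ ∀ f, t f < 0 :=
  ⟨fun _ => P / 2, fun _ => by linarith, fun _ => by linarith⟩

/-- **Conversely, a pin at or above the offset forces chirality of the corresponding up-shift**: the
chiral clause of the conjunct's witness is exactly "no uniform rate above the pin"
(`PinnedThreshold.isChiralAtZero_shift_iff_noUniformRate`). [folklore] -/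
theorem isChiralAtZero_upShift_of_isPin (reg : QCDRegularisation Nf) {P : ℝ} (hP : IsPin reg P) :
    (upShift reg P).IsChiralAtZero := by
  unfold upShift
  rw [Negative.isChiralAtZero_mcrit_shift_iff]
  intro ε hε
  obtain ⟨t, ht, hng⟩ := hP.2 ε hε
  refine ⟨fun f => t f - P, fun f => by linarith [ht f], ?_⟩
  have ht' : (fun f => P + (t f - P)) = t := funext fun f => by ring
  rwa [ht']

end Summit.QuantumFields.QCD.Cruxes.RobustYangMillsHandover.CensusS9
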